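import Literature.AnabelianGeometry.EtaleTheta.Discharge.Sec4NonVacuityCoveringThm44
import Literature.AnabelianGeometry.EtaleTheta.Discharge.Sec4Prop43iOfGaloisSurjNatural
import HarnessLib

/-!
# [EtTh] §4 with a COVERING: Prop 4.3 (i) and the Def 4.1 (ii) laws at the Kummer-tower toy —
# EVERY typed §4 statement holds at one setting (consistency witness, part 6 — complement)

S. Mochizuki, *The étale theta function and its Frobenioid-theoretic manifestations*, Publ. RIMS **45**
(2009) [MochizukiEtTh2009], §4: Def 4.1 (ii) p.87, Prop 4.2 p.88, Prop 4.3 pp.90–91, Thm 4.4 pp.93–95 (PDF).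

CONSISTENCY WITNESS, TOY — joint satisfiability; consistency ≠ faithfulness.  Complement to
`Sec4NonVacuityCovering{,Roots,Thm44}.lean` (p427822, p428415, p428819) answering abc-iut-f-109's request
(2026-08-26T06:29Z): Prop 4.3 (i) at `ToyCov` is abc-iut-f-109's `prop43_i_of_galoisSurjNatural` (p428079)
fed with the outer-naturality law of Def 4.1 (ii), which holds trivially here (`Aut_D(∗) = 1`).  PROOF-ONLY.

* `ToyCov.galoisSurjLaws_and_prop43_i` — abc-iut-L2-t3's two Def 4.1 (ii) laws (`BiKummerGaloisSurjLaws.lean`)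
  hold at `ToyCov.biKummerSetting`, and **Prop 4.3 (i) HOLDS for every transport `pullFrac`** (closer p428079);
  `ToyCov.prop43_i` — the instance for `pullFracModel`;
* `ToyCov.sec4_all_typed` — at ONE explicit setting which IS a Frobenioid, satisfies both Def 4.1 (ii) laws and
  the covering input L01a, ALL the typed §4 statements of `BiKummer.lean`/`BiKummerRoots.lean` —
  Prop 4.2 (i)(ii)(iii)(iv), Prop 4.3 (i)(ii)(iii), Thm 4.4 (i)(ii)(iii)(iv) — hold SIMULTANEOUSLY.

HONEST LIMITS as in parts 6a–6c (one base object, hence divisible exponents; trivial [FrdI] vocabularies;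
`(N,H)`-slot `True`; `Π^tp` trivial over `ℚ̄`; not a curve; typed ≠ proved).  Nothing here bears on, or takes a
side on, [IUTchIII] Cor. 3.12.
-/

noncomputable section

namespace Literature.AnabelianGeometry.EtaleTheta

open CategoryTheory Opposite Literature.AlgebraicGeometry.Frobenioids
open scoped NNRat

namespace ToyCov

/-- **The Def 4.1 (ii) laws and Prop 4.3 (i) at the Kummer-tower toy**: `GaloisSurjNatural` (both Galois
surjections trivial, `c := 1`), `IsOpenKerGaloisSurj` (the kernel of the trivial homomorphism is everything),
and hence — by abc-iut-f-109's `prop43_i_of_galoisSurjNatural` (p428079), `Φ = ℚ_{≥0}` divisorial —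
**Prop 4.3 (i) for EVERY transport `pullFrac`**.  (One conjunction: the three conjuncts print like their
`Toy` namesakes.) [cite: MochizukiEtTh2009, Prop 4.3 (i) p.90–91] -/
theorem galoisSurjLaws_and_prop43_i :
    biKummerSetting.GaloisSurjNatural ∧ biKummerSetting.IsOpenKerGaloisSurj ∧
      ∀ pullFrac : ∀ {A A' : biKummerSetting.C} (_ : A' ⟶ A),
        biKummerSetting.biratUnits A → biKummerSetting.biratUnits A',
        biKummerSetting.Prop43_i pullFrac := by
  have hnat : biKummerSetting.GaloisSurjNatural := fun _ _ _ _ b =>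
    ⟨1, fun g => by
      change ((1 : Toy.temperedGroup.Pi →* Aut _) g).hom ≫ b = b ≫ ((1 : Toy.temperedGroup.Pi →* Aut _) _).hom
      rw [MonoidHom.one_apply, MonoidHom.one_apply]
      exact (Category.id_comp _).trans (Category.comp_id _).symm⟩
  refine ⟨hnat, fun A _ => ?_, fun pullFrac =>
    BiKummerSetting.prop43_i_of_galoisSurjNatural pullFrac (fun A => divisorMonoid_isDivisorial A) hnat⟩
  change IsOpen (((1 : Toy.temperedGroup.Pi →* Aut A)).ker : Set Toy.temperedGroup.Pi)
  rw [MonoidHom.ker_one, Subgroup.coe_top]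
  exact isOpen_univ

/-- **[EtTh] Prop 4.3 (i) HOLDS at the Kummer-tower toy** for the genuine transport `pullFracModel`.
[cite: MochizukiEtTh2009, Prop 4.3 (i) p.90–91] -/
theorem prop43_i : biKummerSetting.Prop43_i fun {_ _} φ => temperedFrobenioid.pullFracModel φ :=
  galoisSurjLaws_and_prop43_i.2.2 fun {_ _} φ => temperedFrobenioid.pullFracModel φ

/-- **ALL typed §4 statements at ONE explicit setting with coverings.**  `ToyCov.biKummerSetting` IS a
Frobenioid, satisfies the Def 4.1 (ii) laws `GaloisSurjNatural` / `IsOpenKerGaloisSurj` and the covering input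
L01a `RootOverCovering`, and the typed Prop 4.2 (i), (ii), (iii), (iv), Prop 4.3 (i), (ii), (iii) and
Thm 4.4 (i)–(iv) (identity self-equivalence, `ψ = id`) hold there SIMULTANEOUSLY (transport `pullFracModel`).
So the complete typed §4 statement set is jointly consistent with the setting axioms, and every landed §4
closer has a jointly satisfiable hypothesis list. [cite: MochizukiEtTh2009, Thm 4.4 p.94] -/
theorem sec4_all_typed :
    PreFrobenioid.IsFrobenioid temperedFrobenioid.toElem ∧
      biKummerSetting.GaloisSurjNatural ∧ biKummerSetting.IsOpenKerGaloisSurj ∧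
      BiKummerSetting.Prop42Sub.RootOverCovering biKummerSetting
        (fun {_ _} φ x => temperedFrobenioid.pullFracModel φ x) ∧
      biKummerSetting.Prop42_i ∧ biKummerSetting.Prop42_ii ∧
      biKummerSetting.Prop42_iii (fun {_ _} φ x => temperedFrobenioid.pullFracModel φ x) ∧
      biKummerSetting.Prop42_iv (fun φ x => temperedFrobenioid.pullFracModel φ x) ∧
      (biKummerSetting.Prop43_i fun {_ _} φ => temperedFrobenioid.pullFracModel φ) ∧
      (biKummerSetting.Prop43_ii fun {_ _} φ => temperedFrobenioid.pullFracModel φ) ∧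
      (biKummerSetting.Prop43_iii fun {_ _} φ => temperedFrobenioid.pullFracModel φ) ∧
      ∃ (h : BiKummerSetting.Thm44Hyp biKummerSetting biKummerSetting)
        (ψ : ∀ A : biKummerSetting.C, biKummerSetting.biratUnits A ≃* biKummerSetting.biratUnits (h.Ψ.functor.obj A)),
        BiKummerSetting.Thm44_i h ∧ BiKummerSetting.Thm44_ii h ψ ∧ BiKummerSetting.Thm44_iii h ψ ∧
          BiKummerSetting.Thm44_iv h ψ (fun {_ _} φ => temperedFrobenioid.pullFracModel φ)
            (fun {_ _} φ => temperedFrobenioid.pullFracModel φ) :=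
  ⟨temperedFrobenioid_isFrobenioid, galoisSurjLaws_and_prop43_i.1, galoisSurjLaws_and_prop43_i.2.1,
    rootOverCovering, prop42_i_and_ii.1, prop42_i_and_ii.2, prop42_iii, prop42_iv, prop43_i, prop43_ii,
    prop43_iii, thm44_id⟩

end ToyCov

end Literature.AnabelianGeometry.EtaleTheta

end
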